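import Summits.QuantumFields.GaugeBoot.DiagonalRPTorusNegative
import HarnessLib

/-!
# Sign characters, link monomials and cuts on `(ℤ/L)³` (gauge-boot, task L3(λ), 1/3)

HONEST FRAMING (cell `pub-gaugeboot`, page 1 of every file): the venture produces certified bounds
on lattice expectations at stated coupling, gauge group, dimension and torus size; NOT a mass gap,
NOT a continuum limit, NOT a string tension; NOT Yang–Mills-summit-bearing (barriers
`FixedCouplingUltralocality`, `PerturbativeInvisibility`). This module is the first of three
(`DiagonalRPTorusSignMonomials` → `DiagonalRPTorusSignExpansion` → `DiagonalRPTorusNegativeThree`)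
proving that closed-half diagonal reflection positivity FAILS on the odd three-torus `(ℤ/3)³` for
gauge groups with a sign character at small `β > 0`
(`DiagRPThree.not_diagonalReflectionPositive_three`); it discharges nothing by itself. It is
written for a general torus size `L` (dimension `3`, mirror `x₀ = x₁`, spectator direction `2`)
so that other finite-torus diagonal statements can be tested with the same machinery.

## Content (bookkeeping only)

* Computable combinatorics of `(ℤ/L)³` in the tree's torus vocabulary (`Site`, `Edge`, `Plaquette`,
  `Site.shift`): link multiplicities `pcnt` of a plaquette, column indicators `ccnt` of the
  direction-`2` Polyakov loops, degrees `degS`, their `θ`-covariance `ccnt_swap`, and the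
  **cut-counting lemma** `card_le_of_cuts`: if a family of pairwise disjoint "cuts" (link sets)
  each separates the two columns `A`, `B` (odd column parity) then every plaquette set whose mod-2
  boundary is `column A + column B` has at least as many plaquettes as there are cuts (handshake
  mod 2).
* The sign character `sgn ρ = Re tr ρ` of a one-dimensional representation
  `ρ : G →* Matrix (Fin 1) (Fin 1) ℂ` with values in `{1, -1}`: multiplicative, inversion
  invariant, `∫ σ^n dHaar = [n even]` (`integral_sgn_pow`, by LEFT INVARIANCE of the Haar
  probability measure against an element of sign `-1` — Haar measure is never identified with
  counting measure); the concrete instance `signRepIntUnits : ℤˣ →* Matrix (Fin 1) (Fin 1) ℂ`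
  (`ℤ₂` lattice gauge theory).
* Link monomials `mono ρ m U = ∏ₑ σ(U_e)^(m e)`: additivity in the exponent, `|mono| ≤ 1`,
  measurability, the plaquette sign as a monomial (`splaq_eq_mono`), Polyakov loops `pol` and
  their `Θ`-covariance (`pol_configDiagSwap`), and the product-Haar integral
  **`integral_mono`**: `∫ ∏ₑ σ(U_e)^(m_e) ∏ₑ dU_e = [every m_e even]` (Fubini,
  `integral_fintype_prod_eq_prod`).

Sources: Osterwalder–Seiler, Ann. Phys. 110 (1978) 440, §2; Kazakov–Zheng, arXiv:2203.11360 §3.1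
(the diagonal reflection family). Elementary; not in print as theorems as far as the cell's searches go.
Printed precedent (nearest-neighbour spin systems, a remark without proof): periodic boundary conditions destroy
diagonal RP — Fröhlich–Israel–Lieb–Simon, J. Stat. Phys. 22 (1980) 297, §3 (Model 3.1); M. Biskup, in LNM 1970
(2009) §5.5; the statements here are theorem-level, gauge-theoretic forms of that obstruction (tribunal t2 F-R1).
-/

open MeasureTheory Complex Finset
open scoped ComplexOrder

namespace Summit.QuantumFields.GaugeBoot

open Literature.MathematicalPhysics.QuantumFieldTheory

namespace DiagRPThree

/-! ## Combinatorics of `(ℤ/L)³` (computable) -/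

section Combinatorics

variable {L : ℕ}

/-- Multiplicity (`0` or `1` when `L ≥ 2`) of the link `e` among the four links
`(x,i), (x+eᵢ,j), (x+eⱼ,i), (x,j)` of the plaquette `p = (x, (i,j))` (the links entering
`plaquetteHolonomy U x i j`). -/
def pcnt (p : Plaquette 3 L) (e : Edge 3 L) : ℕ :=
  (if (p.1, p.2.1.1) = e then 1 else 0) + (if (p.1.shift p.2.1.1, p.2.1.2) = e then 1 else 0) +
    (if (p.1.shift p.2.1.2, p.2.1.1) = e then 1 else 0) + (if (p.1, p.2.1.2) = e then 1 else 0)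

/-- Indicator of the `L` direction-`2` links over the column `A = (a, b) ∈ (ℤ/L)²` (the links of
the Polyakov loop `P_A`). -/
def ccnt (A : ZMod L × ZMod L) (e : Edge 3 L) : ℕ :=
  if e.2 = 2 ∧ e.1 0 = A.1 ∧ e.1 1 = A.2 then 1 else 0

/-- Number of plaquettes of `S` containing the link `e` (the mod-2 boundary of `S` is
`{e : degS S e odd}`). -/
def degS (S : Finset (Plaquette 3 L)) (e : Edge 3 L) : ℕ := ∑ p ∈ S, pcnt p e

/-- A column link has both endpoints over its column. -/
theorem ccnt_ne_zero {A : ZMod L × ZMod L} {e : Edge 3 L} (h : ccnt A e ≠ 0) :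
    e.2 = 2 ∧ e.1 0 = A.1 ∧ e.1 1 = A.2 := by
  unfold ccnt at h
  by_contra hne
  exact h (if_neg hne)

/-- The column indicator is `θ`-covariant: the diagonal swap of the coordinates `0, 1` carries
the column `(a, b)` onto the column `(b, a)`. -/
theorem ccnt_swap (A : ZMod L × ZMod L) (e : Edge 3 L) :
    ccnt A.swap (edgeDiagSwap 0 1 e) = ccnt A e := by
  obtain ⟨y, k⟩ := e
  have h2 : Equiv.swap (0 : Fin 3) 1 k = 2 ↔ k = 2 := by
    constructor
    · intro h
      have := congrArg (Equiv.swap (0 : Fin 3) 1) h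
      rwa [Equiv.swap_apply_self, show Equiv.swap (0 : Fin 3) 1 2 = 2 by decide] at this
    · rintro rfl
      decide
  simp only [ccnt, edgeDiagSwap, siteDiagSwap, Equiv.swap_apply_left, Equiv.swap_apply_right,
    Prod.fst_swap, Prod.snd_swap, h2]
  by_cases hk : k = 2 <;> by_cases ha : y 0 = A.1 <;> by_cases hb : y 1 = A.2 <;> simp [hk, ha, hb]

/-- The exponent of the character expansion, evaluated: `deg_S(e) + [e ∈ A] + [e ∈ B]`. -/
theorem expo_apply (S : Finset (Plaquette 3 L)) (A B : ZMod L × ZMod L) (e : Edge 3 L) :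
    ((∑ p ∈ S, pcnt p) + ccnt A + ccnt B) e = degS S e + ccnt A e + ccnt B e := by
  simp only [Pi.add_apply, Finset.sum_apply, degS]

/-- Parity bookkeeping in `ℕ`: `Even (a + b)` and `Odd b` force `Odd a`. -/
theorem odd_of_even_add_of_odd {a b : ℕ} (h : Even (a + b)) (hb : Odd b) : Odd a := by
  rcases Nat.even_or_odd a with ha | ha
  · exact absurd ((Nat.even_add.1 h).1 ha) (Nat.not_even_iff_odd.2 hb)
  · exact ha

/-- `n + [n odd]` is even. -/
theorem even_add_ite_odd (n : ℕ) : Even (n + if Odd n then 1 else 0) := by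
  split_ifs with h
  · exact h.add_one
  · rw [add_zero]
    exact Nat.not_odd_iff_even.1 h

/-- **The cut-counting lemma (handshake mod 2).** Let `K` index "cuts", each a set of links
`W k`, such that the two columns `A`, `B` together meet `W k` an ODD number of times (`hodd` — the
cut separates the columns) and no plaquette meets two of the `W k` an odd number of times
(`hdisj` — the cuts are disjoint). Then every plaquette set `S` whose mod-2 boundary is
`column A + column B` contains, for each cut, an odd number of plaquettes crossing it, hence at
least `#K` plaquettes. -/
theorem card_le_of_cuts {ι : Type*} (K : Finset ι) (W : ι → Finset (Edge 3 L))
    {A B : ZMod L × ZMod L} (hodd : ∀ k ∈ K, Odd (∑ e ∈ W k, (ccnt A e + ccnt B e)))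
    (hdisj : ∀ p : Plaquette 3 L, (K.filter fun k => Odd (∑ e ∈ W k, pcnt p e)).card ≤ 1)
    {S : Finset (Plaquette 3 L)} (hS : ∀ e, Even (degS S e + ccnt A e + ccnt B e)) :
    K.card ≤ S.card := by
  have hk : ∀ k ∈ K, 1 ≤ (S.filter fun p => Odd (∑ e ∈ W k, pcnt p e)).card := by
    intro k hk
    have h1 : Even (∑ e ∈ W k, (degS S e + (ccnt A e + ccnt B e))) :=
      even_iff_two_dvd.2 (dvd_sum fun e _ => even_iff_two_dvd.1 (by rw [← add_assoc]; exact hS e))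
    rw [sum_add_distrib] at h1
    have h2 : Odd (∑ e ∈ W k, degS S e) := odd_of_even_add_of_odd h1 (hodd k hk)
    have h3 : ∑ e ∈ W k, degS S e = ∑ p ∈ S, ∑ e ∈ W k, pcnt p e := by
      unfold degS
      exact sum_comm
    have h4 : Even (∑ p ∈ S,
        (∑ e ∈ W k, pcnt p e + if Odd (∑ e ∈ W k, pcnt p e) then 1 else 0)) :=
      even_iff_two_dvd.2 (dvd_sum fun p _ => even_iff_two_dvd.1 (even_add_ite_odd _))
    rw [sum_add_distrib, ← h3, sum_boole, Nat.cast_id, add_comm] at h4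
    exact (odd_of_even_add_of_odd h4 h2).pos
  calc K.card = ∑ _k ∈ K, 1 := card_eq_sum_ones K
    _ ≤ ∑ k ∈ K, (S.filter fun p => Odd (∑ e ∈ W k, pcnt p e)).card := sum_le_sum hk
    _ = ∑ k ∈ K, ∑ p ∈ S, (if Odd (∑ e ∈ W k, pcnt p e) then 1 else 0) := by
        refine sum_congr rfl fun k _ => ?_
        rw [sum_boole, Nat.cast_id]
    _ = ∑ p ∈ S, ∑ k ∈ K, (if Odd (∑ e ∈ W k, pcnt p e) then 1 else 0) := sum_comm
    _ = ∑ p ∈ S, (K.filter fun k => Odd (∑ e ∈ W k, pcnt p e)).card := by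
        refine sum_congr rfl fun p _ => ?_
        rw [sum_boole, Nat.cast_id]
    _ ≤ ∑ _p ∈ S, 1 := sum_le_sum fun p _ => hdisj p
    _ = S.card := (card_eq_sum_ones S).symm

end Combinatorics

/-! ## The sign character `σ = Re tr ρ` of a `{±1}`-valued one-dimensional representation -/

section Sign

variable {G : Type*} [Group G] (ρ : G →* Matrix (Fin 1) (Fin 1) ℂ)

/-- `σ(g) = Re ρ(g)₀₀ = Re tr ρ(g)`. -/
def sgn (g : G) : ℝ := ((ρ g) 0 0).re

variable {ρ}

/-- The matrix entry of a `{±1}`-valued representation is `1` or `-1`. -/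
theorem entry_cases (hval : ∀ g, ρ g = 1 ∨ ρ g = -1) (g : G) :
    (ρ g) 0 0 = 1 ∨ (ρ g) 0 0 = -1 := by
  rcases hval g with h | h
  · exact Or.inl (by rw [h, Matrix.one_apply_eq])
  · exact Or.inr (by rw [h, Matrix.neg_apply, Matrix.one_apply_eq])

/-- The entry of a product is the product of the entries (`1 × 1` matrices). -/
theorem entry_mul (g h : G) : (ρ (g * h)) 0 0 = (ρ g) 0 0 * (ρ h) 0 0 := by
  rw [map_mul, Matrix.mul_apply, Fin.sum_univ_one]

/-- `σ(g) ∈ {1, -1}`. -/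
theorem sgn_cases (hval : ∀ g, ρ g = 1 ∨ ρ g = -1) (g : G) : sgn ρ g = 1 ∨ sgn ρ g = -1 := by
  rcases entry_cases hval g with h | h
  · exact Or.inl (by simp [sgn, h])
  · exact Or.inr (by simp [sgn, h])

/-- `σ` is multiplicative. -/
theorem sgn_mul (hval : ∀ g, ρ g = 1 ∨ ρ g = -1) (g h : G) :
    sgn ρ (g * h) = sgn ρ g * sgn ρ h := by
  simp only [sgn, entry_mul]
  rcases entry_cases hval g with h1 | h1 <;> rcases entry_cases hval h with h2 | h2 <;>
    simp [h1, h2]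

/-- `σ(1) = 1`. -/
theorem sgn_one : sgn ρ 1 = 1 := by simp [sgn, map_one, Matrix.one_apply_eq]

/-- `σ(g⁻¹) = σ(g)`. -/
theorem sgn_inv (hval : ∀ g, ρ g = 1 ∨ ρ g = -1) (g : G) : sgn ρ g⁻¹ = sgn ρ g := by
  have h := sgn_mul hval g⁻¹ g
  rw [inv_mul_cancel, sgn_one] at h
  rcases sgn_cases hval g with h1 | h1 <;> rw [h1] at h ⊢ <;> linarith

/-- `Re tr ρ(g) = σ(g)`. -/
theorem trace_re_eq_sgn (g : G) : ((ρ g).trace).re = sgn ρ g := by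
  rw [Matrix.trace_fin_one, sgn]

/-- `σ(g)^n = 1` for even `n` and `= σ(g)` for odd `n`. -/
theorem sgn_pow (hval : ∀ g, ρ g = 1 ∨ ρ g = -1) (g : G) (n : ℕ) :
    sgn ρ g ^ n = if Even n then 1 else sgn ρ g := by
  rcases sgn_cases hval g with h | h
  · rw [h, one_pow]
    split_ifs <;> rfl
  · rw [h]
    rcases Nat.even_or_odd n with hn | hn
    · rw [if_pos hn, hn.neg_one_pow]
    · rw [if_neg (Nat.not_even_iff_odd.2 hn), hn.neg_one_pow]

variable [TopologicalSpace G] [IsTopologicalGroup G] [CompactSpace G] [MeasurableSpace G]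
  [BorelSpace G]

omit [IsTopologicalGroup G] [CompactSpace G] [MeasurableSpace G] [BorelSpace G] in
/-- `σ` is continuous for a continuous representation. -/
theorem continuous_sgn (hρ : Continuous ρ) : Continuous (sgn ρ) :=
  Complex.continuous_re.comp (hρ.matrix_elem 0 0)

/-- `∫ σ dHaar = 0`: translate by an element of sign `-1` (left invariance of Haar measure). -/
theorem integral_sgn (hval : ∀ g, ρ g = 1 ∨ ρ g = -1) (hne : ∃ g, ρ g = -1) :
    ∫ g, sgn ρ g ∂(haarProbability G) = 0 := by
  obtain ⟨g₀, hg₀⟩ := hne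
  have hs0 : sgn ρ g₀ = -1 := by simp [sgn, hg₀, Matrix.neg_apply, Matrix.one_apply_eq]
  have h1 : ∫ g, sgn ρ (g₀ * g) ∂(haarProbability G) = ∫ g, sgn ρ g ∂(haarProbability G) :=
    integral_mul_left_eq_self _ g₀
  have h2 : (fun g => sgn ρ (g₀ * g)) = fun g => -sgn ρ g := by
    funext g
    rw [sgn_mul hval, hs0, neg_one_mul]
  rw [h2, integral_neg] at h1
  linarith

/-- `∫ σ^n dHaar = [n even]`. -/
theorem integral_sgn_pow (hval : ∀ g, ρ g = 1 ∨ ρ g = -1) (hne : ∃ g, ρ g = -1) (n : ℕ) :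
    ∫ g, sgn ρ g ^ n ∂(haarProbability G) = if Even n then 1 else 0 := by
  simp_rw [sgn_pow hval]
  split_ifs with h
  · simp
  · exact integral_sgn hval hne

end Sign

/-! ## The concrete sign character of `ℤˣ = {1, -1}` (`ℤ₂` lattice gauge theory) -/

section IntUnits

/-- The sign representation of `ℤˣ = {1, -1}` by `1 × 1` complex matrices, `u ↦ (u)`. -/
noncomputable def signRepIntUnits : ℤˣ →* Matrix (Fin 1) (Fin 1) ℂ :=
  ((Matrix.scalar (Fin 1) : ℂ →+* Matrix (Fin 1) (Fin 1) ℂ).toMonoidHom.comp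
    (((Int.castRingHom ℂ) : ℤ →+* ℂ).toMonoidHom.comp (Units.coeHom ℤ)))

/-- `signRepIntUnits 1 = 1`, `signRepIntUnits (-1) = -1`. -/
theorem signRepIntUnits_apply (g : ℤˣ) : signRepIntUnits g = if g = 1 then 1 else -1 := by
  rcases Int.units_eq_one_or g with h | h <;> subst h
  · simp [signRepIntUnits]
  · ext i j
    fin_cases i; fin_cases j
    simp [signRepIntUnits]

/-- The sign representation takes the values `1` and `-1` only. -/
theorem signRepIntUnits_eq_one_or (g : ℤˣ) : signRepIntUnits g = 1 ∨ signRepIntUnits g = -1 := by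
  rw [signRepIntUnits_apply]
  split_ifs <;> simp

/-- The sign representation attains `-1`. -/
theorem signRepIntUnits_neg_one : signRepIntUnits (-1) = -1 := by
  rw [signRepIntUnits_apply]
  simp

end IntUnits

/-! ## Link monomials `∏ₑ σ(U_e)^{m_e}` on `(ℤ/L)³` and their product-Haar integrals -/

section Mono

variable {L : ℕ} [NeZero L] {G : Type*} [Group G] (ρ : G →* Matrix (Fin 1) (Fin 1) ℂ)

/-- The link monomial `∏ₑ σ(U_e)^{m(e)}`. -/
def mono (m : Edge 3 L → ℕ) (U : GaugeConfig 3 L G) : ℝ := ∏ e, sgn ρ (U e) ^ m e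

/-- The sign `σ(U_p)` of the plaquette holonomy. -/
def splaq (p : Plaquette 3 L) (U : GaugeConfig 3 L G) : ℝ :=
  sgn ρ (plaquetteHolonomy U p.1 p.2.1.1 p.2.1.2)

/-- The Polyakov loop `P_A(U) = ∏_z σ(U((A,z),2))` over the column `A`, as a link monomial. -/
def pol (A : ZMod L × ZMod L) (U : GaugeConfig 3 L G) : ℝ := mono ρ (ccnt A) U

variable {ρ}

/-- `mono` turns sums of exponents into products. -/
theorem mono_add (m m' : Edge 3 L → ℕ) (U : GaugeConfig 3 L G) :
    mono ρ (m + m') U = mono ρ m U * mono ρ m' U := by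
  simp only [mono, Pi.add_apply, pow_add, prod_mul_distrib]

/-- `mono` of the zero exponent is `1`. -/
theorem mono_zero (U : GaugeConfig 3 L G) : mono ρ 0 U = 1 := by
  simp [mono]

/-- `mono` turns finite sums of exponents into products. -/
theorem mono_sum {ι : Type*} (S : Finset ι) (f : ι → Edge 3 L → ℕ) (U : GaugeConfig 3 L G) :
    mono ρ (∑ i ∈ S, f i) U = ∏ i ∈ S, mono ρ (f i) U := by
  classical
  induction S using Finset.induction_on with
  | empty => simp [mono_zero]
  | insert a s ha ih => rw [sum_insert ha, prod_insert ha, mono_add, ih]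

/-- A link monomial is `±1`. -/
theorem mono_cases (hval : ∀ g, ρ g = 1 ∨ ρ g = -1) (m : Edge 3 L → ℕ) (U : GaugeConfig 3 L G) :
    mono ρ m U = 1 ∨ mono ρ m U = -1 := by
  unfold mono
  refine prod_induction _ (fun x : ℝ => x = 1 ∨ x = -1) ?_ (Or.inl rfl) ?_
  · rintro a b (ha | ha) (hb | hb) <;> simp [ha, hb]
  · intro e _
    rw [sgn_pow hval]
    split_ifs
    · exact Or.inl rfl
    · exact sgn_cases hval (U e)

/-- `|mono| ≤ 1`. -/
theorem abs_mono_le (hval : ∀ g, ρ g = 1 ∨ ρ g = -1) (m : Edge 3 L → ℕ) (U : GaugeConfig 3 L G) :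
    |mono ρ m U| ≤ 1 := by
  rcases mono_cases hval m U with h | h <;> simp [h]

/-- **The plaquette sign is the link monomial of its four links**:
`σ(U_p) = σ(U(x,i)) σ(U(x+eᵢ,j)) σ(U(x+eⱼ,i)) σ(U(x,j))` (`σ` is a `{±1}`-valued character, so
inverses and the order of the factors do not matter). -/
theorem splaq_eq_mono (hval : ∀ g, ρ g = 1 ∨ ρ g = -1) (p : Plaquette 3 L)
    (U : GaugeConfig 3 L G) : splaq ρ p U = mono ρ (pcnt p) U := by
  simp only [mono, pcnt, pow_add, prod_mul_distrib, prod_pow_boole, mem_univ, if_true]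
  rw [splaq, plaquetteHolonomy, sgn_mul hval, sgn_mul hval, sgn_mul hval, sgn_inv hval,
    sgn_inv hval]

/-- **`Θ`-covariance of Polyakov loops**: `P_A ∘ Θ = P_{θA}`, `θ(a,b) = (b,a)`. -/
theorem pol_configDiagSwap (A : ZMod L × ZMod L) (U : GaugeConfig 3 L G) :
    pol ρ A (configDiagSwap 0 1 U) = pol ρ A.swap U := by
  unfold pol mono configDiagSwap
  let θ : Equiv.Perm (Edge 3 L) :=
    Function.Involutive.toPerm (edgeDiagSwap (0 : Fin 3) 1) (edgeDiagSwap_edgeDiagSwap 0 1)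
  refine Fintype.prod_equiv θ _ _ fun e => ?_
  show sgn ρ (U (edgeDiagSwap 0 1 e)) ^ ccnt A e =
    sgn ρ (U (edgeDiagSwap 0 1 e)) ^ ccnt A.swap (edgeDiagSwap 0 1 e)
  rw [ccnt_swap]

/-- Polyakov loops depend only on their own column links. -/
theorem pol_congr (A : ZMod L × ZMod L) {U V : GaugeConfig 3 L G}
    (h : ∀ e : Edge 3 L, ccnt A e ≠ 0 → U e = V e) : pol ρ A U = pol ρ A V := by
  unfold pol mono
  refine prod_congr rfl fun e _ => ?_
  by_cases h0 : ccnt A e = 0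
  · rw [h0, pow_zero, pow_zero]
  · rw [h e h0]

variable [TopologicalSpace G] [IsTopologicalGroup G] [CompactSpace G] [MeasurableSpace G]
  [BorelSpace G]

omit [IsTopologicalGroup G] [CompactSpace G] in
/-- Link monomials are measurable (for a continuous `ρ`). -/
theorem measurable_mono (hρ : Continuous ρ) (m : Edge 3 L → ℕ) :
    Measurable (mono ρ m : GaugeConfig 3 L G → ℝ) := by
  unfold mono
  refine Finset.measurable_prod _ fun e _ => ?_
  exact (((continuous_sgn hρ).measurable.comp (measurable_pi_apply e)).pow_const _)

/-- **Product-Haar integral of a link monomial**: `∫ ∏ₑ σ(U_e)^{m_e} ∏ₑ dU_e = [every m_e even]`. -/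
theorem integral_mono (hval : ∀ g, ρ g = 1 ∨ ρ g = -1) (hne : ∃ g, ρ g = -1)
    (m : Edge 3 L → ℕ) :
    ∫ U, mono ρ m U ∂(Measure.pi fun _ : Edge 3 L => haarProbability G) =
      if ∀ e, Even (m e) then 1 else 0 := by
  unfold mono
  rw [integral_fintype_prod_eq_prod (𝕜 := ℝ) (fun e (g : G) => sgn ρ g ^ m e)]
  simp_rw [integral_sgn_pow hval hne]
  rw [prod_boole]
  simp

end Mono

end DiagRPThree

end Summit.QuantumFields.GaugeBoot
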